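import Literature.MathematicalPhysics.QuantumFieldTheory.Balaban1983to89.Beta.RemainderResidue

/-!
# `Balaban1983to89.Beta.RemainderResidueFamily` — the residue of the k-UNIFORM remainder bound (wall item (D4)) over the FAMILY of
constructions indexed by the activity parameter `ε₁`: `EpsFamily`, `ObjectsFamily`, and their reduction to `RemainderResidue.AtSlope` /
`RemainderChain.RemainderConst` for SOME member (cell pub-balaban-gaps, YM BLITZ track G1, seat g1-p2; a NEW LEAF over
`Beta.RemainderResidue` (p339505) — nothing in the tree is edited)

HONEST FRAMING (cell rule, verbatim): discharging `BetaPertH` makes Bałaban's UV stability UNCONDITIONAL — a real constructive-QFT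
result; it is NOT the continuum limit and NOT the Clay problem.  THIS MODULE DISCHARGES NOTHING of the series: two PREDICATES with
free arguments (hypothesis shapes, never asserted) and `[folklore]`-grade real-number reasoning joining them BY NAME to
`Beta.RemainderResidue` / `Beta.RemainderDecay190HoloChain.ChainTFac190H.abs_beta1_le`.

WHY THIS LEAF (scope correction of `RemainderResidue` §3–§4, recorded plainly).  In [II] the `ε₁` of Lemma 3 (2.38) is the
construction's OWN small-field threshold — the analyticity strip `{B : |B| < ε₁g_k⁻¹}` of (1.34) p. 9, the characteristic functions
`χ_{k,Y₀}`, `χ^c_{k,P}` with threshold `ε₁g_k⁻¹` of (2.22) p. 16, the contour radius (2.18) p. 16, `C₃ε₁` in (2.38) p. 20.  So the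
effective actions (2.13) — hence the β-functions (1.22) and their one-loop split — DEPEND on `ε₁`, and «ε₁ sufficiently small» ([II]
p. 21; [I] Thm 3 p. 264 *"There exist positive constants … such, that"*) CHOOSES A MEMBER of a family `e ↦ (β_e, Sβ_e)` of
constructions.  `RemainderResidue.EpsUniform Sβ` / `ObjectsUniform Sβ` (p339505) ask ONE split to admit EVERY smaller activity
parameter: valid sufficient conditions (all their theorems stand), inhabited by the trivial step, but NOT the shape expected of
Bałaban's fixed-ε₁ construction (a fixed construction's activities H(Z) do not shrink with the coupling box) — they are exactly the
CONSTANT-FAMILY cases of this leaf (`epsFamily_const_of_epsUniform`, `objectsFamily_const_of_objectsUniform`).  THE RESIDUE OF RECORD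
for Bałaban's scheme: `ObjectsFamily βf Sf` ⟹ `EpsFamily βf Sf` ⟹ for every slope `s > 0` SOME member satisfies
`RemainderResidue.AtSlope (Sf e) γ₀ s` (explicit member threshold: `atSlope_member_of_objectsFamily`); for the ONE construction of the
wall, whose `ε₁` is already fixed with `ε₁·K_rem,L ≤ stepBal` (N3), the residue is `RemainderResidue.AtSlope` itself.

ABSOLUTE RULE (cell charter, verbatim): "No internally-minted statement may enter as a cited fact. …"  The `[cite: …]` tags below are
CONTEXT ONLY (which printed display a hypothesis SHAPE types); no tag imports a fact.

CITATION HEADER.  [I] = [Balaban1987RG1] Commun. Math. Phys. 109: Thm 2 p. 259, Thm 3 p. 264, (1.20)–(1.22) p. 264, (5.10) p. 293;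
[II] = [Balaban1988RG2Cluster] Commun. Math. Phys. 116: (1.34) p. 9, (2.18)/(2.22) p. 16, Lemma 3 (2.38) p. 20, p. 21; [15] =
[Balaban1985Variational] Commun. Math. Phys. 102: (190) p. 308.  Quotations as certified in the imported modules; (1.34), (2.18),
(2.22) re-read for this leaf on the renders `pub-balaban/b2b-balaban-ref1/pages/1988-cmp116-rg-II-cluster-p015…p020-x2.png`
(cell record `pub-balaban-gaps/g1/D4-NODEA-K0-LINEREAD.md`).  No `sorry`, no axiom beyond the standard trio, no fact minted.
-/

namespace Literature.MathematicalPhysics.QuantumFieldTheory.Balaban1983to89.Beta.RemainderResidueFamily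

open Literature.MathematicalPhysics.QuantumFieldTheory.Balaban1983to89
open FlowStep
open Literature.MathematicalPhysics.QuantumFieldTheory.Balaban1983to89.Beta.RemainderChain (RemainderConst)
open Literature.MathematicalPhysics.QuantumFieldTheory.Balaban1983to89.Beta.RemainderChainLattice (CondsL SignsL remCoeffL)
open Literature.MathematicalPhysics.QuantumFieldTheory.Balaban1983to89.Beta.RemainderDecay190 (Consts190)
open Literature.MathematicalPhysics.QuantumFieldTheory.Balaban1983to89.Beta.RemainderDecay190HoloChain (ChainTFac190H)
open Literature.MathematicalPhysics.QuantumFieldTheory.Balaban1983to89.Beta.RemainderResidue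
  (AtSlope EpsUniform ObjectsUniform constsAt remainderConst_restrict remainderConst_of_atSlope remCoeffL_constsAt condsL_constsAt)

noncomputable section

/-- `(constsAt c e).ε₁ = e` (plumbing, re-proved locally). [folklore] -/
private theorem constsAt_eps1 (c : B13.Consts) (e : ℝ) : (constsAt c e).ε₁ = e := rfl

/-- The sign record for every smaller non-negative activity (re-proved locally). [folklore] -/
private theorem signsL_constsAt {c : B13.Consts} {α₂ B₃ : ℝ} (hs : SignsL c α₂ B₃) (hC3 : 0 ≤ c.C3act) {e : ℝ}
    (he : 0 ≤ e) : SignsL (constsAt c e) α₂ B₃ :=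
  ⟨show 0 ≤ c.C3act * e from mul_nonneg hC3 he, hs.α₂_pos, hs.B₃_nonneg, hs.δ₀_pos⟩

/-- `0 ≤ C₃·ε₁` with `ε₁ > 0` gives `0 ≤ C₃` (re-proved locally). [folklore] -/
private theorem C3act_nonneg_of_signsL {c : B13.Consts} {α₂ B₃ : ℝ} (hs : SignsL c α₂ B₃) (hε : 0 < c.ε₁) : 0 ≤ c.C3act := by
  by_contra h
  have : c.C3act * c.ε₁ < 0 := mul_neg_of_neg_of_pos (not_le.mp h) hε
  linarith [hs.A]

/-! ## §1. `EpsFamily` — the ε₁-uniform residue over the FAMILY of constructions indexed by the activity parameter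

WHY A FAMILY.  In [II] the activity parameter `ε₁` of Lemma 3 (2.38) is the construction's OWN small-field threshold: the analyticity
strip `{B : |B| < ε₁g_k⁻¹}` of (1.34) p. 9, the characteristic functions `χ_{k,Y₀}`, `χ^c_{k,P}` with threshold `ε₁g_k⁻¹` in (2.22) p. 16,
the contour radius (2.18) p. 16 and `C₃ε₁` in (2.38) p. 20.  So the effective actions (2.13) — hence the β-functions (1.22) and their
split — DEPEND on `ε₁`: choosing «ε₁ sufficiently small» ([II] p. 21) = choosing the CONSTRUCTION ([I] Thm 3 p. 264 *"There exist
positive constants … such, that"*).  The print-faithful residue is therefore NOT «one split admitting every smaller activity» (a fixed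
construction's activities H(Z) do not shrink with the coupling box) but: a FAMILY `e ↦ (β_e, Sβ_e)` of β-families with splits, one per
activity parameter `e`, each admitting the chain at ITS OWN `e` on some box, with the other constants and `K_rem,L` uniform in `e`.  For ONE
construction whose `ε₁` was already chosen `≤ s / K_rem,L` the residue is `RemainderResidue.AtSlope`.  (`RemainderResidue.EpsUniform Sβ` = the CONSTANT family, `epsFamily_const_of_epsUniform`.) -/

/-- **`EpsFamily βf Sf` — the ε₁-UNIFORM residue over a family of constructions**: `βf e` = the history-dependent β-functions of the
construction built with activity / small-field parameter `e`, `Sf e` its one-loop split; there are `M, (μ, ν), ℓ, α₂, q`, a bound `K` and a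
threshold `ε₀ > 0`, and for every `e ∈ ]0, ε₀]` a [II]-record `cOf e` WITH `(cOf e).ε₁ = e` meeting N1–N2, with `K_rem,L(4, M, cOf e, α₂,
B₃(q)) ≤ K` UNIFORMLY in `e`, and a box `γ₀(e) > 0` on which `ChainTFac190H 4 M μ ν (Sf e) γ₀ (cOf e) ℓ α₂ q` is inhabited — the printed
ORDER OF CONSTANTS as a displayed quantifier ([II] p. 21 *"for κ sufficiently large, and ε₁ sufficiently small"*; [I] Thm 3 p. 264 *"The
constant γ depends on all other constants"*).  A PREDICATE (hypothesis shape), never asserted; for Bałaban's family no inhabitant exists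
in the tree.  (The CONSTANT family `fun _ => Sβ` is the special case «one split admitting every smaller activity» — inhabited by the
trivial step, NOT expected of Bałaban's construction.)
[cite: Balaban1988RG2Cluster, (1.34) p.9, (2.22) p.16, Lemma 3 (2.38) p.20 and p.21; Balaban1987RG1, Thm 3 p.264 and (1.20)-(1.22) p.264] -/
def EpsFamily (βf : ℝ → HBeta) (Sf : (e : ℝ) → B12Beta.OneLoopSplit (βf e)) : Prop :=
  ∃ (M : ℕ) (_ : NeZero M) (μ ν : Fin 4) (ℓ α₂ : ℝ) (q : Consts190) (K ε₀ : ℝ) (cOf : ℝ → B13.Consts),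
    0 < ε₀ ∧ ∀ e : ℝ, 0 < e → e ≤ ε₀ →
      (cOf e).ε₁ = e ∧ CondsL 4 (cOf e) ℓ ∧ (cOf e).R22gen ℓ ∧ q.Valid (cOf e).δ₀ ∧ SignsL (cOf e) α₂ q.B₃ ∧
        remCoeffL 4 M (cOf e) α₂ q.B₃ ≤ K ∧ ∃ γ₀ : ℝ, 0 < γ₀ ∧ Nonempty (ChainTFac190H 4 M μ ν (Sf e) γ₀ (cOf e) ℓ α₂ q)

/-- **The family residue gives, for EVERY slope `s > 0`, a MEMBER of the family (an activity parameter `e`, i.e. a choice of the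
construction) satisfying the slope-`s` residue on some box** — `e := min ε₀ (s / K)` when `K > 0`, `e := ε₀` otherwise: the printed
«ε₁ sufficiently small» read against the one-loop slope. [cite: Balaban1988RG2Cluster, p.21 (after (2.39)); Balaban1987RG1, Thm 3 p.264] -/
theorem exists_atSlope_of_epsFamily {βf : ℝ → HBeta} {Sf : (e : ℝ) → B12Beta.OneLoopSplit (βf e)} (h : EpsFamily βf Sf) {s : ℝ}
    (hs : 0 < s) : ∃ e : ℝ, 0 < e ∧ ∃ γ₀ : ℝ, 0 < γ₀ ∧ AtSlope (Sf e) γ₀ s := by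
  obtain ⟨M, hM, μ, ν, ℓ, α₂, q, K, ε₀, cOf, hε₀, hall⟩ := h
  -- the activity parameter: `min ε₀ (s / K)` if `K > 0`, else `ε₀`
  obtain ⟨e, he, heε, heK⟩ : ∃ e : ℝ, 0 < e ∧ e ≤ ε₀ ∧ e * K ≤ s := by
    by_cases hK : 0 < K
    · refine ⟨min ε₀ (s / K), lt_min hε₀ (div_pos hs hK), min_le_left _ _, ?_⟩
      calc min ε₀ (s / K) * K ≤ s / K * K := mul_le_mul_of_nonneg_right (min_le_right _ _) hK.le
        _ = s := div_mul_cancel₀ s hK.ne'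
    · exact ⟨ε₀, hε₀, le_rfl, (mul_nonpos_iff.mpr (Or.inl ⟨hε₀.le, not_lt.mp hK⟩)).trans hs.le⟩
  obtain ⟨hε₁, hC, h22, hq, hsg, hKe, γ₀, hγ₀, hR⟩ := hall e he heε
  refine ⟨e, he, γ₀, hγ₀, M, hM, μ, ν, cOf e, ℓ, α₂, q, hR, hC, h22, hq, hsg, ?_⟩
  rw [hε₁]
  exact (mul_le_mul_of_nonneg_left hKe he.le).trans heK

/-- **The family residue gives the constant form (D4) AT EVERY POSITIVE SLOPE for some member of the family on some box.**
[cite: Balaban1987RG1, Thm 2 p.259 and Thm 3 p.264; Balaban1988RG2Cluster, (2.38) p.20 and p.21] -/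
theorem exists_remainderConst_of_epsFamily {βf : ℝ → HBeta} {Sf : (e : ℝ) → B12Beta.OneLoopSplit (βf e)}
    (h : EpsFamily βf Sf) {s : ℝ} (hs : 0 < s) :
    ∃ e : ℝ, 0 < e ∧ ∃ γ₀ : ℝ, 0 < γ₀ ∧ RemainderConst (Sf e) γ₀ s := by
  obtain ⟨e, he, γ₀, hγ₀, hres⟩ := exists_atSlope_of_epsFamily h hs
  exact ⟨e, he, γ₀, hγ₀, remainderConst_of_atSlope hres⟩

/-- The same on a box inside any PRESCRIBED box `]0, γc]` (antitone in the box; [I] Thm 3 p. 264: γ is chosen after all other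
constants) — the form in which it meets a continuity hypothesis given on `]0, γc]`. [cite: Balaban1987RG1, Thm 3 p.264 and Thm 2 p.259] -/
theorem exists_remainderConst_le_of_epsFamily {βf : ℝ → HBeta} {Sf : (e : ℝ) → B12Beta.OneLoopSplit (βf e)}
    (h : EpsFamily βf Sf) {s γc : ℝ} (hs : 0 < s) (hγc : 0 < γc) :
    ∃ e : ℝ, 0 < e ∧ ∃ γ₁ : ℝ, 0 < γ₁ ∧ γ₁ ≤ γc ∧ RemainderConst (Sf e) γ₁ s := by
  obtain ⟨e, he, γ₀, hγ₀, hR⟩ := exists_remainderConst_of_epsFamily h hs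
  exact ⟨e, he, min γ₀ γc, lt_min hγ₀ hγc, min_le_right _ _, remainderConst_restrict (min_le_left _ _) hR⟩

/-! ## §2. `ObjectsFamily` — the pure object residue over the family (numerics discharged generically via `RemainderResidue.constsAt`,
`remCoeffL_constsAt`, `condsL_constsAt`) -/

/-- **`ObjectsFamily βf Sf` — THE PURE OBJECT RESIDUE over the family of constructions** (d = 4): ONE cube side `M`, channel `(μ, ν)`,
[II]-record `c` with `c.ε₁ > 0` meeting N1 (`CondsL`), the closing relation, ONE (190)-record `q` meeting N2 (`Valid`, `SignsL`), and —
the only non-numeric clause — for EVERY activity parameter `e ∈ ]0, c.ε₁]` a box `γ₀(e) > 0` and an INHABITANT of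
`ChainTFac190H 4 M μ ν (Sf e) γ₀ (constsAt c e) ℓ α₂ q` (holomorphic currency): the construction-`e` one-step objects with the printed
leaves ([II] Lemma 3 (2.38) with activity `C₃ e`, [I] (4.4)/(4.35)/p. 282, [15] (190), (1.7), (1.20)–(1.22) for `(Sf e).β1`) on the
coupling box chosen after `e`.  (`constsAt c e` freezes EVERY other letter of the record `c`, including its field `γ`, which is a dead letter
here — the coupling box is the separate `γ₀(e)`; `EpsFamily`'s free record family `cOf` lets the other letters vary with `e` if wanted — row-D4
owner's remark R1′, an4 g85.)  NO smallness-versus-slope clause remains (it is produced in `exists_atSlope_of_epsFamily`).  A PREDICATE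
(hypothesis shape), never asserted; for Bałaban's family no inhabitant exists in the tree — its inhabitation IS the construction of
Bałaban's small-field one-step objects (cell ledger L1–L11), uniformly in the activity parameter.
[cite: Balaban1988RG2Cluster, Lemma 3 (2.38) p.20 and p.21; Balaban1987RG1, Thm 3 p.264 and (1.20)-(1.22) p.264; Balaban1985Variational, (190) p.308] -/
def ObjectsFamily (βf : ℝ → HBeta) (Sf : (e : ℝ) → B12Beta.OneLoopSplit (βf e)) : Prop :=
  ∃ (M : ℕ) (_ : NeZero M) (μ ν : Fin 4) (c : B13.Consts) (ℓ α₂ : ℝ) (q : Consts190),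
    0 < c.ε₁ ∧ CondsL 4 c ℓ ∧ c.R22gen ℓ ∧ q.Valid c.δ₀ ∧ SignsL c α₂ q.B₃ ∧
      ∀ e : ℝ, 0 < e → e ≤ c.ε₁ → ∃ γ₀ : ℝ, 0 < γ₀ ∧ Nonempty (ChainTFac190H 4 M μ ν (Sf e) γ₀ (constsAt c e) ℓ α₂ q)

/-- **The pure object residue gives the ε₁-uniform residue** (records `e ↦ constsAt c e` on `]0, c.ε₁]`, bound `K := K_rem,L` at `c`):
every numeric side condition N1–N3 is discharged GENERICALLY in the activity parameter.
[cite: Balaban1988RG2Cluster, p.21 (after (2.39)); Balaban1987RG1, Thm 3 p.264] -/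
theorem epsFamily_of_objectsFamily {βf : ℝ → HBeta} {Sf : (e : ℝ) → B12Beta.OneLoopSplit (βf e)} (h : ObjectsFamily βf Sf) :
    EpsFamily βf Sf := by
  obtain ⟨M, hM, μ, ν, c, ℓ, α₂, q, hε, hC, h22, hq, hs, hall⟩ := h
  have hC3 : 0 ≤ c.C3act := C3act_nonneg_of_signsL hs hε
  refine ⟨M, hM, μ, ν, ℓ, α₂, q, remCoeffL 4 M c α₂ q.B₃, c.ε₁, constsAt c, hε, fun e he hle => ?_⟩
  obtain ⟨γ₀, hγ₀, hR⟩ := hall e he hle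
  exact ⟨constsAt_eps1 c e, condsL_constsAt hC hC3 hle, h22, hq, signsL_constsAt hs hC3 he.le,
    (remCoeffL_constsAt 4 M c e α₂ q.B₃).le, γ₀, hγ₀, hR⟩

/-- **END TO END at the statement layer**: the pure object residue gives, for every positive slope and every prescribed box, a member
of the family satisfying the constant form (D4) on a box inside the prescribed one.
[cite: Balaban1987RG1, Thm 2 p.259 and Thm 3 p.264; Balaban1988RG2Cluster, (2.38) p.20 and p.21] -/
theorem exists_remainderConst_le_of_objectsFamily {βf : ℝ → HBeta} {Sf : (e : ℝ) → B12Beta.OneLoopSplit (βf e)}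
    (h : ObjectsFamily βf Sf) {s γc : ℝ} (hs : 0 < s) (hγc : 0 < γc) :
    ∃ e : ℝ, 0 < e ∧ ∃ γ₁ : ℝ, 0 < γ₁ ∧ γ₁ ≤ γc ∧ RemainderConst (Sf e) γ₁ s :=
  exists_remainderConst_le_of_epsFamily (epsFamily_of_objectsFamily h) hs hγc

/-- **ONE construction with a suitable activity parameter**: if the family is inhabited in the pure-object sense and a member `e` has
`e · K_rem,L ≤ s` (its activity parameter already small against the slope — the wall's N3 read as «ε₁ WAS chosen small»), that member
satisfies §2's `AtSlope` — the link back to the single-construction residue. [cite: Balaban1988RG2Cluster, p.21 (after (2.39))] -/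
theorem atSlope_member_of_objectsFamily {βf : ℝ → HBeta} {Sf : (e : ℝ) → B12Beta.OneLoopSplit (βf e)}
    (h : ObjectsFamily βf Sf) : ∃ K c₁ : ℝ, 0 < c₁ ∧ ∀ e : ℝ, 0 < e → e ≤ c₁ → ∀ s : ℝ, e * K ≤ s →
      ∃ γ₀ : ℝ, 0 < γ₀ ∧ AtSlope (Sf e) γ₀ s := by
  obtain ⟨M, hM, μ, ν, c, ℓ, α₂, q, hε, hC, h22, hq, hs, hall⟩ := h
  have hC3 : 0 ≤ c.C3act := C3act_nonneg_of_signsL hs hε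
  refine ⟨remCoeffL 4 M c α₂ q.B₃, c.ε₁, hε, fun e he hle s hsK => ?_⟩
  obtain ⟨γ₀, hγ₀, hR⟩ := hall e he hle
  refine ⟨γ₀, hγ₀, M, hM, μ, ν, constsAt c e, ℓ, α₂, q, hR, condsL_constsAt hC hC3 hle, h22, hq,
    signsL_constsAt hs hC3 he.le, ?_⟩
  show e * remCoeffL 4 M (constsAt c e) α₂ q.B₃ ≤ s
  rw [remCoeffL_constsAt]
  exact hsK

/-- `RemainderResidue.EpsUniform Sβ` (one split, every smaller activity) IS the constant-family case of `EpsFamily` (the reading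
in which «ε₁ sufficiently small» does not change the construction). [cite: Balaban1988RG2Cluster, p.21 (after (2.39))] -/
theorem epsFamily_const_of_epsUniform {β : HBeta} {Sβ : B12Beta.OneLoopSplit β} (h : EpsUniform Sβ) :
    EpsFamily (fun _ => β) (fun _ => Sβ) := h

/-- `RemainderResidue.ObjectsUniform Sβ` IS the constant-family case of `ObjectsFamily` (same reading). [cite: Balaban1988RG2Cluster, p.21 (after (2.39))] -/
theorem objectsFamily_const_of_objectsUniform {β : HBeta} {Sβ : B12Beta.OneLoopSplit β} (h : ObjectsUniform Sβ) :
    ObjectsFamily (fun _ => β) (fun _ => Sβ) := h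

end

end Literature.MathematicalPhysics.QuantumFieldTheory.Balaban1983to89.Beta.RemainderResidueFamily
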